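import Summits.CriticalPhenomena.PercolationContinuityZ3.Theorems.PercNearOneGluingNoHeavyLowerTailTformOneSteinerGateTools
import HarnessLib

/-!
# `NoHeavyLowerTail` (stmt-CriticalPhenomena-4575) — the T-form (XZ) at an observer with relay gates and ONE further
# neighbour: single-gate domination in `G`, QGATE-T at `|S| = 1`, and XZ at the champion

Support file (prover `prim-hp-5`, hull-port cell, T-form calculus, gen 3; `--supports stmt-CriticalPhenomena-4575`).
No definitions, no named facts, no sorries.  Notation: `μ = prodBernoulli w` on `Fin n`, relays `A`, observer `o ∉ A`,
level `j`, `N = |π(o)|`, `L = {1 ≤ N ≤ j}`, `R_x = {|π(x)| ≤ j}`, `𝔸 = {1 ≤ N}`; `K = G − o` read on `ω ∩ {e | o ∉ e}`,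
`Φ_K(x) = μ{|π'(x)| ≤ j}` (any vertex `x`), `Φ_G(x) = μ(R_x)`; the GATES of `o` are its positive-weight neighbours; the
T-form at `o` with witness `c` (stubs `stub_attachedChampion(Deleted)`) is `μ(L) ≤ μ(R_c ∩ 𝔸)`.
SETTING: every gate of `o` is a relay except possibly ONE vertex `s`, behind which the graph is ARBITRARY (for `s`
relay-neighboured in `K` this is Kozma–Nitzan's Theorem 5 configuration; `Theorems.cil_oneSteiner` proves CIL for champions
under that restriction).  Here: no restriction on `s`, the sharper T-form, an explicit witness set.

* `tform_of_reference_oneSteinerGate` — **ONE-STEINER-GATE TRANSFER.**  `p ≠ o` any vertex with `Φ_K(y) ≤ Φ_K(p)` for every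
  gate `y`, and `c ≠ o` with `Φ_K(c) ≤ Φ_K(p)`, `Φ_G(p) ≤ Φ_G(c)` ⇒ `μ(L) ≤ μ(R_c ∩ 𝔸)`.  Proof: for EVERY star `B` of `o`,
  `μ(L ∩ σ_B) ≤ μ(R_c ∩ 𝔸 ∩ σ_B) + μ(R_p ∩ σ_B) − μ(R_c ∩ σ_B)` (relay member: star transfer with the lonelier member, BHK, and
  `σ_B ⊆ 𝔸`; empty star: no `L` and `μ(σ_∅)(Φ_K(p) − Φ_K(c)) ≥ 0`; `σ_{s}`: read in `K`, where
  `μ{1 ≤ |π'(s)| ≤ j} − μ{1 ≤ |π'(s)|, |π'(c)| ≤ j} ≤ Φ_K(s) − Φ_K(c) ≤ Φ_K(p) − Φ_K(c)`); sum over the stars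
  (`KNPreFKG.real_eq_sum_inter_starEvent`) and use `Φ_G(p) ≤ Φ_G(c)`.  Tools: file `…TformOneSteinerGateTools`.
* `tform_of_dominates_lightestGate` — **SINGLE-GATE DOMINATION (SGD):** `g` a `K`-lightest gate, `Φ_G(g) ≤ Φ_G(c)`, `c ≠ o`
  ⇒ `μ(L) ≤ μ(R_c ∩ 𝔸)` (else-branch: `c` K-dominates every gate, `Theorems.attachedChampion_of_gates_dominated`).  Extends
  `SinglePortDomination.tform_of_dominates_lightestPort` (prover `prim-lf-8`: all gates relays) to one non-relay gate.
Corollaries (QGATE-T at `|S| = 1` for this class; XZ at the champion when a relay K-dominates the gates): file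
`…TformOneSteinerGateChampion`.
Numerics (this seat, `lab/one_steiner_test.py`, `lab/z_test.py`): identities to 1e-16; 0 violations / 3 271 instances.
-/

noncomputable section

namespace Summit.CriticalPhenomena.PercolationContinuityZ3.Theorems

open MeasureTheory Set Literature.Probability.LatticeModels Literature.Probability.Percolation
open scoped Classical BigOperators

variable {n : ℕ}

open CutObserver KNPreFKG in
/-- **ONE-STEINER-GATE TRANSFER.**  Let `o ∉ A`, and let every positive-weight neighbour of `o` be a relay or the vertex
`s ≠ o` (behind which the graph is arbitrary).  Let `p ≠ o` be a vertex with `Φ_K(y) ≤ Φ_K(p)` for every positive-weight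
neighbour `y` of `o`, and `c ≠ o` a vertex with `Φ_K(c) ≤ Φ_K(p)` and `Φ_G(p) ≤ Φ_G(c)` (`Φ_K` = lightness with the pairs at
`o` removed, `Φ_G` = lightness).  Then `μ{1 ≤ N ≤ j} ≤ μ({|π(c)| ≤ j} ∩ {1 ≤ N})` — the T-form (conclusion of
`stub_attachedChampion`) at this observer with witness `c`.  Per-star inequality
`μ(L ∩ σ_B) ≤ μ(R_c ∩ 𝔸 ∩ σ_B) + μ(R_p ∩ σ_B) − μ(R_c ∩ σ_B)` summed over the stars of `o`.
[cite: VandenbergHaggstromKahn2005, Thm. 1.5 (p. 7); KozmaNitzan2024, Lemma 5 and Thm. 5 (pp. 13–14) — star decomposition, one extra vertex] -/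
theorem tform_of_reference_oneSteinerGate (w : Sym2 (Fin n) → unitInterval) (A : Finset (Fin n)) (o s p c : Fin n) (j : ℕ)
    (hoA : o ∉ A) (hso : s ≠ o) (hpo : p ≠ o) (hco : c ≠ o)
    (hgates : ∀ y : Fin n, y ≠ o → w s(o, y) ≠ 0 → y ∈ A ∨ y = s)
    (hdom : ∀ y : Fin n, y ≠ o → w s(o, y) ≠ 0 →
      (prodBernoulli w).real {ω : BondConfig (Fin n) |
          (A.filter fun z => (openGraph (ω ∩ {e | o ∉ e})).Reachable y z).card ≤ j} ≤
        (prodBernoulli w).real {ω : BondConfig (Fin n) |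
          (A.filter fun z => (openGraph (ω ∩ {e | o ∉ e})).Reachable p z).card ≤ j})
    (hKc : (prodBernoulli w).real {ω : BondConfig (Fin n) |
          (A.filter fun z => (openGraph (ω ∩ {e | o ∉ e})).Reachable c z).card ≤ j} ≤
        (prodBernoulli w).real {ω : BondConfig (Fin n) |
          (A.filter fun z => (openGraph (ω ∩ {e | o ∉ e})).Reachable p z).card ≤ j})
    (hG : (prodBernoulli w).real {ω : BondConfig (Fin n) | (A.filter fun z => ω ∈ openConn p z).card ≤ j} ≤
      (prodBernoulli w).real {ω : BondConfig (Fin n) | (A.filter fun z => ω ∈ openConn c z).card ≤ j}) :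
    (prodBernoulli w).real {ω : BondConfig (Fin n) |
        1 ≤ (A.filter fun x => ω ∈ openConn o x).card ∧ (A.filter fun x => ω ∈ openConn o x).card ≤ j} ≤
      (prodBernoulli w).real {ω : BondConfig (Fin n) |
        (A.filter fun x => ω ∈ openConn c x).card ≤ j ∧ 1 ≤ (A.filter fun x => ω ∈ openConn o x).card} := by
  haveI : IsProbabilityMeasure (prodBernoulli w) := inferInstance
  set μ := prodBernoulli w with hμ
  -- events
  set L := {ω : BondConfig (Fin n) |
    1 ≤ (A.filter fun x => ω ∈ openConn o x).card ∧ (A.filter fun x => ω ∈ openConn o x).card ≤ j} with hL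
  set RcA := {ω : BondConfig (Fin n) |
    (A.filter fun x => ω ∈ openConn c x).card ≤ j ∧ 1 ≤ (A.filter fun x => ω ∈ openConn o x).card} with hRcA
  set Rc := {ω : BondConfig (Fin n) | (A.filter fun z => ω ∈ openConn c z).card ≤ j} with hRc
  set Rp := {ω : BondConfig (Fin n) | (A.filter fun z => ω ∈ openConn p z).card ≤ j} with hRp
  -- `K`-lightness
  set sW : Fin n → ℝ := fun y => μ.real {ω : BondConfig (Fin n) |
    (A.filter fun z => (openGraph (ω ∩ {e | o ∉ e})).Reachable y z).card ≤ j} with hsW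
  change ∀ y : Fin n, y ≠ o → w s(o, y) ≠ 0 → sW y ≤ sW p at hdom
  change sW c ≤ sW p at hKc
  change μ.real Rp ≤ μ.real Rc at hG
  -- gates of `o`
  set Γ : Finset (Fin n) := Finset.univ.filter fun v => v ≠ o ∧ w s(o, v) ≠ 0 with hΓ
  have hΓo : o ∉ Γ := by
    rw [hΓ, Finset.mem_filter]; exact fun h => h.2.1 rfl
  have hiso : ∀ v, v ≠ o → v ∉ Γ → w s(o, v) = 0 := by
    intro v hvo hvΓ
    by_contra hne
    exact hvΓ (Finset.mem_filter.2 ⟨Finset.mem_univ _, hvo, hne⟩)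
  -- ### the per-star inequality
  have hstar : ∀ B ∈ Γ.powerset,
      μ.real (L ∩ starEvent o ↑B) ≤
        μ.real (RcA ∩ starEvent o ↑B) + (μ.real (Rp ∩ starEvent o ↑B) - μ.real (Rc ∩ starEvent o ↑B)) := by
    intro B hB
    have hBΓ : B ⊆ Γ := Finset.mem_powerset.1 hB
    have hBo : ∀ y ∈ B, y ≠ o := fun y hy => (Finset.mem_filter.1 (hBΓ hy)).2.1
    by_cases hrel : ∃ y ∈ B, y ∈ A
    · -- ### a star with a relay member: star transfer with the lonelier member, and `σ_B ⊆ 𝔸`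
      obtain ⟨y, hyB, hyA⟩ := hrel
      have hyΓ := Finset.mem_filter.1 (hBΓ hyB)
      have hy : sW y ≤ sW p := hdom y hyΓ.2.1 hyΓ.2.2
      -- (a) μ(L ∩ σ_B) ≤ μ(Rp ∩ σ_B)
      have hLp : μ.real (L ∩ starEvent o ↑B) ≤ μ.real (Rp ∩ starEvent o ↑B) := by
        refine star_transfer w A o p j hoA hpo B hBo ?_
        by_cases hpB : p ∈ B
        · refine measureReal_mono (fun ω hω => ?_) (measure_ne_top _ _)
          exact absurd (SimpleGraph.Reachable.refl p) (hω.1 p hpB)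
        have e1 : ∀ x : Fin n, {ω : BondConfig (Fin n) |
              (A.filter fun z => (openGraph (ω ∩ {e | o ∉ e})).Reachable x z).card ≤ j} =
            {ω : BondConfig (Fin n) | ω ∩ {e | o ∉ e} ∈
              {ξ : BondConfig (Fin n) | (A.filter fun z => ξ ∈ openConn x z).card ≤ j}} := by
          intro x; ext ω; simp only [mem_setOf_eq, filter_avoid_eq]
        have hle : (prodBernoulli fun e => if e ∈ {e : Sym2 (Fin n) | o ∉ e} then w e else 0).real
              {ξ : BondConfig (Fin n) | (A.filter fun z => ξ ∈ openConn y z).card ≤ j} ≤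
            (prodBernoulli fun e => if e ∈ {e : Sym2 (Fin n) | o ∉ e} then w e else 0).real
              {ξ : BondConfig (Fin n) | (A.filter fun z => ξ ∈ openConn p z).card ≤ j} := by
          have h := hy
          simp only [hsW] at h
          rw [e1 y, e1 p, measureReal_preimage_avoid, measureReal_preimage_avoid] at h
          exact h
        have key := observerSet_le_of_lonelier (fun e => if e ∈ {e : Sym2 (Fin n) | o ∉ e} then w e else 0)
          A B y p hyB j hle
        have e2 : {ω : BondConfig (Fin n) |
              (∀ y ∈ B, ¬ (openGraph (ω ∩ {e | o ∉ e})).Reachable p y) ∧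
                1 ≤ (A.filter fun z => ∃ y ∈ B, (openGraph (ω ∩ {e | o ∉ e})).Reachable y z).card ∧
                (A.filter fun z => ∃ y ∈ B, (openGraph (ω ∩ {e | o ∉ e})).Reachable y z).card ≤ j} =
            {ω : BondConfig (Fin n) | ω ∩ {e | o ∉ e} ∈
              {ξ : BondConfig (Fin n) | (∀ x ∈ B, ξ ∉ openConn p x) ∧
                1 ≤ (A.filter fun z => ∃ x ∈ B, ξ ∈ openConn x z).card ∧
                (A.filter fun z => ∃ x ∈ B, ξ ∈ openConn x z).card ≤ j}} := by
          ext ω; simp only [mem_setOf_eq, filter_avoid_exists_eq]; exact Iff.rfl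
        have e3 : {ω : BondConfig (Fin n) |
              (∀ y ∈ B, ¬ (openGraph (ω ∩ {e | o ∉ e})).Reachable p y) ∧
                (A.filter fun z => (openGraph (ω ∩ {e | o ∉ e})).Reachable p z).card ≤ j} =
            {ω : BondConfig (Fin n) | ω ∩ {e | o ∉ e} ∈
              {ξ : BondConfig (Fin n) | (∀ x ∈ B, ξ ∉ openConn p x) ∧
                (A.filter fun z => ξ ∈ openConn p z).card ≤ j}} := by
          ext ω; simp only [mem_setOf_eq, filter_avoid_eq]; exact Iff.rfl
        rw [e2, e3, measureReal_preimage_avoid, measureReal_preimage_avoid]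
        convert key using 12
      -- (b) RcA ∩ σ_B = Rc ∩ σ_B  (a relay member is attached)
      have hAB : RcA ∩ starEvent o ↑B = Rc ∩ starEvent o ↑B := by
        ext ω
        simp only [hRcA, hRc, mem_inter_iff, mem_setOf_eq]
        constructor
        · rintro ⟨⟨h1, _⟩, h2⟩; exact ⟨h1, h2⟩
        · rintro ⟨h1, h2⟩
          refine ⟨⟨h1, Finset.card_pos.2 ⟨y, Finset.mem_filter.2 ⟨hyA, ?_⟩⟩⟩, h2⟩
          have hoy : s(o, y) ∈ ω := ((mem_starEvent_iff o (↑B) ω).1 h2 y (hBo y hyB)).2 (Finset.mem_coe.2 hyB)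
          have hadj : (openGraph ω).Adj o y := by
            rw [openGraph_adj]; exact ⟨hoy, (hBo y hyB).symm⟩
          exact hadj.reachable
      rw [hAB]
      linarith
    · -- ### no relay member: `B ⊆ {s}`, so `B = ∅` or `B = {s}`
      push Not at hrel
      have hBs : B ⊆ {s} := by
        intro y hy
        rcases hgates y (hBo y hy) (Finset.mem_filter.1 (hBΓ hy)).2.2 with hA | hys
        · exact absurd hA (hrel y hy)
        · exact Finset.mem_singleton.2 hys
      rcases Finset.subset_singleton_iff.1 hBs with rfl | rfl
      · -- #### the empty star: no `L`, and `μ(σ_∅)·(Φ_K(p) − Φ_K(c)) ≥ 0`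
        have h0 : L ∩ starEvent o ↑(∅ : Finset (Fin n)) = (∅ : Set (BondConfig (Fin n))) := by
          ext ω
          simp only [mem_inter_iff, mem_empty_iff_false, iff_false, not_and]
          intro hLω hσ
          rw [Finset.coe_empty] at hσ
          obtain ⟨x, hx⟩ := Finset.card_pos.1 (lt_of_lt_of_le Nat.zero_lt_one hLω.1)
          rw [Finset.mem_filter] at hx
          exact not_reachable_of_mem_starEvent_empty hσ (fun h => hoA (h ▸ hx.1)) hx.2
        have hRx : ∀ x : Fin n, x ≠ o →
            μ.real ({ω : BondConfig (Fin n) | (A.filter fun z => ω ∈ openConn x z).card ≤ j} ∩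
              starEvent o ↑(∅ : Finset (Fin n))) = μ.real (starEvent o ↑(∅ : Finset (Fin n))) * sW x := by
          intro x hxo
          have hset : {ω : BondConfig (Fin n) | (A.filter fun z => ω ∈ openConn x z).card ≤ j} ∩
              starEvent o ↑(∅ : Finset (Fin n)) =
              starEvent o ↑(∅ : Finset (Fin n)) ∩ {ω : BondConfig (Fin n) |
                (A.filter fun z => (openGraph ((ω ∩ {e | o ∉ e}))).Reachable x z).card ≤ j} := by
            ext ω
            simp only [mem_inter_iff, mem_setOf_eq]
            constructor
            · rintro ⟨h1, h2⟩
              refine ⟨h2, ?_⟩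
              rw [Finset.coe_empty] at h2
              rw [← filter_eq_avoid_of_star_empty A h2 hxo]; exact h1
            · rintro ⟨h2, h1⟩
              refine ⟨?_, h2⟩
              have h2' := h2
              rw [Finset.coe_empty] at h2'
              rw [filter_eq_avoid_of_star_empty A h2' hxo]; exact h1
          rw [hset]
          exact measureReal_starEvent_inter_avoid w o ↑(∅ : Finset (Fin n))
            (fun ξ => (A.filter fun z => (openGraph ξ).Reachable x z).card ≤ j)
        rw [h0, measureReal_empty, hRx p hpo, hRx c hco]
        have h1 : 0 ≤ μ.real (RcA ∩ starEvent o ↑(∅ : Finset (Fin n))) := measureReal_nonneg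
        have h2 : 0 ≤ μ.real (starEvent o ↑(∅ : Finset (Fin n))) * (sW p - sW c) :=
          mul_nonneg measureReal_nonneg (by linarith)
        nlinarith
      · -- #### the star `{s}`: everything is read in `K`
        have hsΓ : s ∈ Γ := hBΓ (Finset.mem_singleton_self s)
        have hsdom : sW s ≤ sW p := hdom s hso (Finset.mem_filter.1 hsΓ).2.2
        have hcoe : (↑({s} : Finset (Fin n)) : Set (Fin n)) = ({s} : Set (Fin n)) := Finset.coe_singleton s
        -- `K`-events
        set PL : BondConfig (Fin n) → Prop := fun ξ =>
          1 ≤ (A.filter fun z => (openGraph ξ).Reachable s z).card ∧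
            (A.filter fun z => (openGraph ξ).Reachable s z).card ≤ j with hPL
        set PR : BondConfig (Fin n) → Prop := fun ξ =>
          (A.filter fun z => (openGraph ξ).Reachable c z).card ≤ j ∧
            1 ≤ (A.filter fun z => (openGraph ξ).Reachable s z).card with hPR
        set Px : Fin n → BondConfig (Fin n) → Prop := fun x ξ =>
          (A.filter fun z => (openGraph ξ).Reachable x z).card ≤ j with hPx
        have hLs : L ∩ starEvent o ↑({s} : Finset (Fin n)) =
            starEvent o ↑({s} : Finset (Fin n)) ∩ {ω | PL (ω ∩ {e | o ∉ e})} := by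
          ext ω
          simp only [hL, mem_inter_iff, mem_setOf_eq, hPL]
          constructor
          · rintro ⟨h1, h2⟩
            have h2' := h2; rw [hcoe] at h2'
            rw [filter_obs_eq_of_star_singleton A h2' hoA hso] at h1
            exact ⟨h2, h1⟩
          · rintro ⟨h2, h1⟩
            have h2' := h2; rw [hcoe] at h2'
            rw [← filter_obs_eq_of_star_singleton A h2' hoA hso] at h1
            exact ⟨h1, h2⟩
        have hRs : RcA ∩ starEvent o ↑({s} : Finset (Fin n)) =
            starEvent o ↑({s} : Finset (Fin n)) ∩ {ω | PR (ω ∩ {e | o ∉ e})} := by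
          ext ω
          simp only [mem_inter_iff, mem_setOf_eq, hPR, hRcA]
          constructor
          · rintro ⟨⟨h1, h3⟩, h2⟩
            have h2' := h2; rw [hcoe] at h2'
            rw [filter_obs_eq_of_star_singleton A h2' hoA hso] at h3
            rw [filter_eq_avoid_of_star_singleton A h2' hoA hco] at h1
            exact ⟨h2, h1, h3⟩
          · rintro ⟨h2, h1, h3⟩
            have h2' := h2; rw [hcoe] at h2'
            rw [← filter_obs_eq_of_star_singleton A h2' hoA hso] at h3
            rw [← filter_eq_avoid_of_star_singleton A h2' hoA hco] at h1
            exact ⟨⟨h1, h3⟩, h2⟩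
        have hRx : ∀ x : Fin n, x ≠ o →
            {ω : BondConfig (Fin n) | (A.filter fun z => ω ∈ openConn x z).card ≤ j} ∩
              starEvent o ↑({s} : Finset (Fin n)) =
              starEvent o ↑({s} : Finset (Fin n)) ∩ {ω | Px x (ω ∩ {e | o ∉ e})} := by
          intro x hxo
          ext ω
          simp only [mem_inter_iff, mem_setOf_eq, hPx]
          constructor
          · rintro ⟨h1, h2⟩
            have h2' := h2; rw [hcoe] at h2'
            rw [filter_eq_avoid_of_star_singleton A h2' hoA hxo] at h1
            exact ⟨h2, h1⟩
          · rintro ⟨h2, h1⟩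
            have h2' := h2; rw [hcoe] at h2'
            rw [← filter_eq_avoid_of_star_singleton A h2' hoA hxo] at h1
            exact ⟨h1, h2⟩
        rw [hLs, hRs, hRx p hpo, hRx c hco,
          measureReal_starEvent_inter_avoid w o _ PL, measureReal_starEvent_inter_avoid w o _ PR,
          measureReal_starEvent_inter_avoid w o _ (Px p), measureReal_starEvent_inter_avoid w o _ (Px c)]
        -- the `K`-inequality: bad'_s − V'_s(c) ≤ Φ_K(s) − Φ_K(c) ≤ Φ_K(p) − Φ_K(c)
        have hPp : μ.real {ω | Px p (ω ∩ {e | o ∉ e})} = sW p := rfl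
        have hPc : μ.real {ω | Px c (ω ∩ {e | o ∉ e})} = sW c := rfl
        set Ns : BondConfig (Fin n) → ℕ := fun ω =>
          (A.filter fun z => (openGraph (ω ∩ {e | o ∉ e})).Reachable s z).card with hNs
        set Ncl : BondConfig (Fin n) → ℕ := fun ω =>
          (A.filter fun z => (openGraph (ω ∩ {e | o ∉ e})).Reachable c z).card with hNcl
        have hK : μ.real {ω | PL (ω ∩ {e | o ∉ e})} ≤ μ.real {ω | PR (ω ∩ {e | o ∉ e})} + (sW s - sW c) := by
          -- bad' = Φ_K(s) − μ{Ns = 0};  V'(c) ≥ Φ_K(c) − μ{Ns = 0}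
          set Z := {ω : BondConfig (Fin n) | ¬ 1 ≤ Ns ω} with hZ
          have hbad : μ.real {ω | PL (ω ∩ {e | o ∉ e})} + μ.real Z = sW s := by
            have hunion : {ω : BondConfig (Fin n) | Ns ω ≤ j} = {ω | PL (ω ∩ {e | o ∉ e})} ∪ Z := by
              ext ω
              simp only [mem_union, mem_setOf_eq, hPL, hZ]
              constructor
              · intro h
                by_cases h1 : 1 ≤ Ns ω
                · exact Or.inl ⟨h1, h⟩
                · exact Or.inr h1
              · rintro (⟨_, h⟩ | h)
                · exact h
                · show Ns ω ≤ j
                  omega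
            have hdisj : Disjoint {ω | PL (ω ∩ {e | o ∉ e})} Z := by
              rw [Set.disjoint_left]
              rintro ω ⟨h1, _⟩ h2
              exact h2 h1
            have := measureReal_union hdisj (MeasurableSet.of_discrete (s := Z)) (μ := μ)
              (measure_ne_top _ _) (measure_ne_top _ _)
            rw [← hunion] at this
            simp only [hsW]
            linarith
          have hV : sW c ≤ μ.real {ω | PR (ω ∩ {e | o ∉ e})} + μ.real Z := by
            have hsub : {ω : BondConfig (Fin n) | Ncl ω ≤ j} ⊆ {ω | PR (ω ∩ {e | o ∉ e})} ∪ Z := by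
              intro ω h
              simp only [mem_union, mem_setOf_eq, hPR, hZ]
              by_cases h1 : 1 ≤ Ns ω
              · exact Or.inl ⟨h, h1⟩
              · exact Or.inr h1
            calc sW c = μ.real {ω : BondConfig (Fin n) | Ncl ω ≤ j} := rfl
              _ ≤ μ.real ({ω | PR (ω ∩ {e | o ∉ e})} ∪ Z) := measureReal_mono hsub (measure_ne_top _ _)
              _ ≤ μ.real {ω | PR (ω ∩ {e | o ∉ e})} + μ.real Z := measureReal_union_le _ _
          linarith
        rw [hPp, hPc]
        have hσ0 : 0 ≤ μ.real (starEvent o (↑({s} : Finset (Fin n)) : Set (Fin n))) := measureReal_nonneg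
        have h3 : μ.real (starEvent o (↑({s} : Finset (Fin n)) : Set (Fin n))) * μ.real {ω | PL (ω ∩ {e | o ∉ e})} ≤
            μ.real (starEvent o (↑({s} : Finset (Fin n)) : Set (Fin n))) *
              (μ.real {ω | PR (ω ∩ {e | o ∉ e})} + (sW p - sW c)) :=
          mul_le_mul_of_nonneg_left (by linarith) hσ0
        nlinarith
  -- ### summing over the stars
  have hdecL := real_eq_sum_inter_starEvent w Γ o hΓo hiso L
  have hdecA := real_eq_sum_inter_starEvent w Γ o hΓo hiso RcA
  have hdecp := real_eq_sum_inter_starEvent w Γ o hΓo hiso Rp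
  have hdecc := real_eq_sum_inter_starEvent w Γ o hΓo hiso Rc
  change μ.real L ≤ μ.real RcA
  rw [hdecL, hdecA]
  calc ∑ B ∈ Γ.powerset, μ.real (L ∩ starEvent o ↑B)
      ≤ ∑ B ∈ Γ.powerset, (μ.real (RcA ∩ starEvent o ↑B) +
          (μ.real (Rp ∩ starEvent o ↑B) - μ.real (Rc ∩ starEvent o ↑B))) := Finset.sum_le_sum hstar
    _ = ∑ B ∈ Γ.powerset, μ.real (RcA ∩ starEvent o ↑B) +
          (∑ B ∈ Γ.powerset, μ.real (Rp ∩ starEvent o ↑B) - ∑ B ∈ Γ.powerset, μ.real (Rc ∩ starEvent o ↑B)) := by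
        rw [Finset.sum_add_distrib, Finset.sum_sub_distrib]
    _ = ∑ B ∈ Γ.powerset, μ.real (RcA ∩ starEvent o ↑B) + (μ.real Rp - μ.real Rc) := by rw [← hdecp, ← hdecc]
    _ ≤ ∑ B ∈ Γ.powerset, μ.real (RcA ∩ starEvent o ↑B) := by linarith

open CutObserver in
/-- **SINGLE-GATE DOMINATION (SGD) with one non-relay gate.**  Let `o ∉ A` have relay gates and possibly the one further
neighbour `s ≠ o` (arbitrary graph behind `s`).  If `g ≠ o` is a positive-weight neighbour of `o` that is `K`-LIGHTEST among
the gates (`Φ_K(y) ≤ Φ_K(g)` for every gate `y`) and `c ≠ o` satisfies `Φ_G(g) ≤ Φ_G(c)`, then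
`μ{1 ≤ N ≤ j} ≤ μ({|π(c)| ≤ j} ∩ {1 ≤ N})`.  Extends `SinglePortDomination.tform_of_dominates_lightestPort` (all gates relays).
[cite: VandenbergHaggstromKahn2005, Thm. 1.5 (p. 7)] -/
theorem tform_of_dominates_lightestGate (w : Sym2 (Fin n) → unitInterval) (A : Finset (Fin n)) (o s g c : Fin n)
    (j : ℕ) (hoA : o ∉ A) (hso : s ≠ o) (hgo : g ≠ o) (hco : c ≠ o)
    (hgates : ∀ y : Fin n, y ≠ o → w s(o, y) ≠ 0 → y ∈ A ∨ y = s)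
    (hdom : ∀ y : Fin n, y ≠ o → w s(o, y) ≠ 0 →
      (prodBernoulli w).real {ω : BondConfig (Fin n) |
          (A.filter fun z => (openGraph (ω ∩ {e | o ∉ e})).Reachable y z).card ≤ j} ≤
        (prodBernoulli w).real {ω : BondConfig (Fin n) |
          (A.filter fun z => (openGraph (ω ∩ {e | o ∉ e})).Reachable g z).card ≤ j})
    (hG : (prodBernoulli w).real {ω : BondConfig (Fin n) | (A.filter fun z => ω ∈ openConn g z).card ≤ j} ≤
      (prodBernoulli w).real {ω : BondConfig (Fin n) | (A.filter fun z => ω ∈ openConn c z).card ≤ j}) :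
    (prodBernoulli w).real {ω : BondConfig (Fin n) |
        1 ≤ (A.filter fun x => ω ∈ openConn o x).card ∧ (A.filter fun x => ω ∈ openConn o x).card ≤ j} ≤
      (prodBernoulli w).real {ω : BondConfig (Fin n) |
        (A.filter fun x => ω ∈ openConn c x).card ≤ j ∧ 1 ≤ (A.filter fun x => ω ∈ openConn o x).card} := by
  by_cases hKc : (prodBernoulli w).real {ω : BondConfig (Fin n) |
          (A.filter fun z => (openGraph (ω ∩ {e | o ∉ e})).Reachable c z).card ≤ j} ≤
        (prodBernoulli w).real {ω : BondConfig (Fin n) |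
          (A.filter fun z => (openGraph (ω ∩ {e | o ∉ e})).Reachable g z).card ≤ j}
  · exact tform_of_reference_oneSteinerGate w A o s g c j hoA hso hgo hco hgates hdom hKc hG
  · -- `c` K-dominates every gate
    push Not at hKc
    exact attachedChampion_of_gates_dominated w A o c j hoA hco fun y hyo hwy => (hdom y hyo hwy).trans hKc.le

end Summit.CriticalPhenomena.PercolationContinuityZ3.Theorems

end
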